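import Literature.Topology.FourManifolds.SurfaceGroupHomology
import Literature.LinearAlgebra.Matrix.IntegerElementaryMatrices
import HarnessLib

/-!
# Elementary symplectic moves on `H₁(Σ_g; ℤ)`: isometry, coordinates, and Euclid's algorithm on a
# handle (Zieschang–Vogt–Coldewey §3.6, 3.6.9–3.6.10)

Topic `Literature/Topology/FourManifolds`; theorems only, over the definitions of
`SurfaceGroupHomology.lean` (`symplForm` = the intersection form `ν` on `ι × Bool → ℤ`,
the moves `moveX i c : bᵢ ↦ bᵢ + c aᵢ`, `moveY i c : aᵢ ↦ aᵢ + c bᵢ` (type (A)),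
`moveZ i j c : aⱼ ↦ aⱼ + c aᵢ, bᵢ ↦ bᵢ - c bⱼ` (type (C)), `moveW i j c : bᵢ ↦ bᵢ + c aⱼ,
bⱼ ↦ bⱼ + c aᵢ`).  Proved here:

* coordinate formulas for the four moves and the vectors they fix (`move?_apply_*`,
  `move?_eq_self`); each move is an isometry of `ν` (`symplForm_moveX/Y/Z/W`), as ZVC 3.6.9
  asserts for its generators ("the following matrices solve the equation `XᵗKX = K`");
* `apply_handle_eq_zero` — an isometry fixing `δ_{aⱼ}, δ_{bⱼ}` preserves the vanishing of the
  coordinates of handle `j`;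
* `exists_mem_apply_true_eq_zero`, `exists_mem_forall_apply_true_eq_zero` — **Euclid's algorithm
  on a handle**, ZVC 3.6.10 first step ("there is a matrix `B` of type (A) such that `Bx` has the
  form `(x₁', 0, x₂', 0, …, x_g', 0)ᵗ`"): inside any subgroup `G'` of automorphisms containing the
  moves of type (A) on the handles of `s`, every vector can be moved to one whose
  `b`-coordinates on `s` vanish, touching no other handle;
* `rot_sq_apply` (the rotation `X(1)Y(-1)X(1)` squares to the sign change of a handle) and
  `moveZ_moveZ_single` (`Z_{ji}(-1) Z_{ij}(1) δ_{aⱼ} = δ_{aᵢ}`), the two bookkeeping identities of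
  the second step of 3.6.10.

The statements quantify over an arbitrary subgroup `G'` containing the relevant moves, so that
the same lemmas serve subgroups cut down by stabiliser and isometry conditions (sequel
`SymplecticBasisTransitivity.lean`, which finishes 3.6.10 / Cor. 3.6.12).

## References

* H. Zieschang, E. Vogt, H.-D. Coldewey, *Surfaces and Planar Discontinuous Groups*, LNM 835,
  Springer (1980), §3.6: 3.6.9 (A)–(C), 3.6.10. [ZieschangVogtColdewey1980]
-/

noncomputable section

namespace Literature.Topology.FourManifolds

open Finset

section MoveLemmas

variable {ι : Type*} [DecidableEq ι]

omit [DecidableEq ι] in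
/-- Pointwise group law of `≃ₗ` automorphisms. [folklore] -/
theorem linearEquiv_mul_apply (f g : (ι × Bool → ℤ) ≃ₗ[ℤ] (ι × Bool → ℤ)) (v : ι × Bool → ℤ) :
    (f * g) v = f (g v) := rfl

/-- `moveX` changes only the `aᵢ`-coordinate. [folklore] -/
theorem moveX_apply_of_ne (i : ι) (c : ℤ) (v : ι × Bool → ℤ) {x : ι × Bool} (hx : x ≠ (i, false)) :
    moveX i c v x = v x := by
  simp [moveX_apply, Pi.single_eq_of_ne hx]

/-- `moveX` on the `aᵢ`-coordinate. [folklore] -/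
@[simp] theorem moveX_apply_false (i : ι) (c : ℤ) (v : ι × Bool → ℤ) :
    moveX i c v (i, false) = v (i, false) + c * v (i, true) := by
  simp [moveX_apply]

/-- `moveX` on the `bᵢ`-coordinate. [folklore] -/
@[simp] theorem moveX_apply_true (i : ι) (c : ℤ) (v : ι × Bool → ℤ) (j : ι) :
    moveX i c v (j, true) = v (j, true) :=
  moveX_apply_of_ne i c v (by simp)

/-- `moveY` changes only the `bᵢ`-coordinate. [folklore] -/
theorem moveY_apply_of_ne (i : ι) (c : ℤ) (v : ι × Bool → ℤ) {x : ι × Bool} (hx : x ≠ (i, true)) :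
    moveY i c v x = v x := by
  simp [moveY_apply, Pi.single_eq_of_ne hx]

/-- `moveY` on the `bᵢ`-coordinate. [folklore] -/
@[simp] theorem moveY_apply_true (i : ι) (c : ℤ) (v : ι × Bool → ℤ) :
    moveY i c v (i, true) = v (i, true) + c * v (i, false) := by
  simp [moveY_apply]

/-- `moveY` on `a`-coordinates. [folklore] -/
@[simp] theorem moveY_apply_false (i : ι) (c : ℤ) (v : ι × Bool → ℤ) (j : ι) :
    moveY i c v (j, false) = v (j, false) :=
  moveY_apply_of_ne i c v (by simp)

/-- `moveZ` off the two coordinates it changes. [folklore] -/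
theorem moveZ_apply_of_ne {i j : ι} (h : i ≠ j) (c : ℤ) (v : ι × Bool → ℤ) {x : ι × Bool}
    (hx : x ≠ (i, false)) (hx' : x ≠ (j, true)) : moveZ i j h c v x = v x := by
  simp [moveZ_apply, Pi.single_eq_of_ne hx, Pi.single_eq_of_ne hx']

/-- `moveZ` on the `aᵢ`-coordinate. [folklore] -/
@[simp] theorem moveZ_apply_false {i j : ι} (h : i ≠ j) (c : ℤ) (v : ι × Bool → ℤ) :
    moveZ i j h c v (i, false) = v (i, false) + c * v (j, false) := by
  simp [moveZ_apply]

/-- `moveZ` on the `bⱼ`-coordinate. [folklore] -/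
@[simp] theorem moveZ_apply_true {i j : ι} (h : i ≠ j) (c : ℤ) (v : ι × Bool → ℤ) :
    moveZ i j h c v (j, true) = v (j, true) - c * v (i, true) := by
  simp [moveZ_apply]
  ring

/-- `moveW` off the two coordinates it changes. [folklore] -/
theorem moveW_apply_of_ne (i j : ι) (c : ℤ) (v : ι × Bool → ℤ) {x : ι × Bool}
    (hx : x ≠ (j, false)) (hx' : x ≠ (i, false)) : moveW i j c v x = v x := by
  simp [moveW_apply, Pi.single_eq_of_ne hx, Pi.single_eq_of_ne hx']

/-- `moveW` on the `aⱼ`-coordinate (`i ≠ j`). [folklore] -/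
@[simp] theorem moveW_apply_false_right {i j : ι} (h : i ≠ j) (c : ℤ) (v : ι × Bool → ℤ) :
    moveW i j c v (j, false) = v (j, false) + c * v (i, true) := by
  have : ((j, false) : ι × Bool) ≠ (i, false) := by simpa using h.symm
  simp [moveW_apply, Pi.single_eq_of_ne this]

/-- `moveW` on the `aᵢ`-coordinate (`i ≠ j`). [folklore] -/
@[simp] theorem moveW_apply_false_left {i j : ι} (h : i ≠ j) (c : ℤ) (v : ι × Bool → ℤ) :
    moveW i j c v (i, false) = v (i, false) + c * v (j, true) := by
  have : ((i, false) : ι × Bool) ≠ (j, false) := by simpa using h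
  simp [moveW_apply, Pi.single_eq_of_ne this]

/-- `moveW` on `b`-coordinates. [folklore] -/
@[simp] theorem moveW_apply_true (i j : ι) (c : ℤ) (v : ι × Bool → ℤ) (k : ι) :
    moveW i j c v (k, true) = v (k, true) :=
  moveW_apply_of_ne i j c v (by simp) (by simp)

/-- `moveX` fixes vectors with vanishing `bᵢ`-coordinate. [folklore] -/
theorem moveX_eq_self {i : ι} (c : ℤ) {v : ι × Bool → ℤ} (h : v (i, true) = 0) : moveX i c v = v := by
  simp [moveX_apply, h]

/-- `moveY` fixes vectors with vanishing `aᵢ`-coordinate. [folklore] -/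
theorem moveY_eq_self {i : ι} (c : ℤ) {v : ι × Bool → ℤ} (h : v (i, false) = 0) : moveY i c v = v := by
  simp [moveY_apply, h]

/-- `moveZ` fixes vectors with vanishing `aⱼ`- and `bᵢ`-coordinates. [folklore] -/
theorem moveZ_eq_self {i j : ι} (hij : i ≠ j) (c : ℤ) {v : ι × Bool → ℤ} (h : v (j, false) = 0)
    (h' : v (i, true) = 0) : moveZ i j hij c v = v := by
  simp [moveZ_apply, h, h']

/-- `moveW` fixes vectors with vanishing `bᵢ`- and `bⱼ`-coordinates. [folklore] -/
theorem moveW_eq_self {i j : ι} (c : ℤ) {v : ι × Bool → ℤ} (h : v (i, true) = 0)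
    (h' : v (j, true) = 0) : moveW i j c v = v := by
  simp [moveW_apply, h, h']

end MoveLemmas

section Isometry

variable {ι : Type*} [Fintype ι] [DecidableEq ι]

/-- `moveX` preserves the intersection form. [cite: ZieschangVogtColdewey1980, 3.6.9] -/
theorem symplForm_moveX (i : ι) (c : ℤ) (u u' : ι × Bool → ℤ) :
    symplForm (moveX i c u) (moveX i c u') = symplForm u u' := by
  simp only [moveX_apply, map_add, map_smul, LinearMap.add_apply, LinearMap.smul_apply,
    symplForm_single_false_left, symplForm_single_false_right, smul_eq_mul]
  simp

/-- `moveY` preserves the intersection form. [cite: ZieschangVogtColdewey1980, 3.6.9] -/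
theorem symplForm_moveY (i : ι) (c : ℤ) (u u' : ι × Bool → ℤ) :
    symplForm (moveY i c u) (moveY i c u') = symplForm u u' := by
  simp only [moveY_apply, map_add, map_smul, LinearMap.add_apply, LinearMap.smul_apply,
    symplForm_single_true_left, symplForm_single_true_right, smul_eq_mul]
  simp

/-- `moveZ` preserves the intersection form. [cite: ZieschangVogtColdewey1980, 3.6.9] -/
theorem symplForm_moveZ {i j : ι} (h : i ≠ j) (c : ℤ) (u u' : ι × Bool → ℤ) :
    symplForm (moveZ i j h c u) (moveZ i j h c u') = symplForm u u' := by
  simp only [moveZ_apply, map_add, map_smul, map_sub, LinearMap.add_apply, LinearMap.smul_apply,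
    LinearMap.sub_apply, symplForm_single_true_left, symplForm_single_true_right,
    symplForm_single_false_left, symplForm_single_false_right, smul_eq_mul]
  simp [h, h.symm]
  ring

/-- `moveW` preserves the intersection form. [folklore] -/
theorem symplForm_moveW {i j : ι} (h : i ≠ j) (c : ℤ) (u u' : ι × Bool → ℤ) :
    symplForm (moveW i j c u) (moveW i j c u') = symplForm u u' := by
  simp only [moveW_apply, map_add, map_smul, LinearMap.add_apply, LinearMap.smul_apply,
    symplForm_single_false_left, symplForm_single_false_right, smul_eq_mul]
  simp [h, h.symm]
  ring

/-- A symplectic automorphism fixing `δ_{aⱼ}` and `δ_{bⱼ}` preserves the vanishing of the two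
coordinates of handle `j`. [folklore] -/
theorem apply_handle_eq_zero (f : (ι × Bool → ℤ) ≃ₗ[ℤ] (ι × Bool → ℤ))
    (hf : ∀ u u', symplForm (f u) (f u') = symplForm u u') (j : ι)
    (he : f (Pi.single (j, false) 1) = Pi.single (j, false) 1)
    (hf' : f (Pi.single (j, true) 1) = Pi.single (j, true) 1) (u : ι × Bool → ℤ)
    (hu : u (j, false) = 0) (hu' : u (j, true) = 0) : f u (j, false) = 0 ∧ f u (j, true) = 0 := by
  constructor
  · have := hf u (Pi.single (j, true) 1)
    rw [hf', symplForm_single_true_right, symplForm_single_true_right, hu] at this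
    simpa using this
  · have := hf (Pi.single (j, false) 1) u
    rw [he, symplForm_single_false_left, symplForm_single_false_left, hu'] at this
    simpa using this

end Isometry

section Euclid

variable {ι : Type*} [DecidableEq ι]

/-- **Euclid on one handle** (ZVC 3.6.10, first step: "there is a matrix `B` of type (A) such
that `Bx` has the form `(x₁', 0, …)`"): the moves `moveX i ·`, `moveY i ·` of a subgroup `G'`
kill the `bᵢ`-coordinate of any vector, touching no other handle.
[cite: ZieschangVogtColdewey1980, 3.6.10] -/
theorem exists_mem_apply_true_eq_zero (G' : Subgroup ((ι × Bool → ℤ) ≃ₗ[ℤ] (ι × Bool → ℤ)))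
    (i : ι) (hX : ∀ c, moveX i c ∈ G') (hY : ∀ c, moveY i c ∈ G') :
    ∀ (n : ℕ) (v : ι × Bool → ℤ), (v (i, true)).natAbs ≤ n →
      ∃ f ∈ G', f v (i, true) = 0 ∧ ∀ x : ι × Bool, x.1 ≠ i → f v x = v x := by
  intro n
  induction n with
  | zero =>
    intro v hv
    exact ⟨1, G'.one_mem, by simpa using hv, fun x _ => rfl⟩
  | succ n ih =>
    intro v hv
    by_cases hq : v (i, true) = 0
    · exact ⟨1, G'.one_mem, hq, fun x _ => rfl⟩
    -- `(p, q) ↦ (p mod q, q)`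
    have h₁f : moveX i (-(v (i, false) / v (i, true))) v (i, false) = v (i, false) % v (i, true) := by
      rw [moveX_apply_false, Int.emod_def]; ring
    have h₁t : moveX i (-(v (i, false) / v (i, true))) v (i, true) = v (i, true) :=
      moveX_apply_true _ _ _ _
    have h₁o : ∀ x : ι × Bool, x.1 ≠ i → moveX i (-(v (i, false) / v (i, true))) v x = v x :=
      fun x hx => moveX_apply_of_ne i _ v (by rintro rfl; exact hx rfl)
    by_cases hr : v (i, false) % v (i, true) = 0
    · -- `(0, q) ↦ (q, q) ↦ (q, 0)`
      refine ⟨moveY i (-1) * moveX i 1 * moveX i (-(v (i, false) / v (i, true))),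
        G'.mul_mem (G'.mul_mem (hY _) (hX _)) (hX _), ?_, ?_⟩
      · rw [linearEquiv_mul_apply, linearEquiv_mul_apply, moveY_apply_true, moveX_apply_true,
          moveX_apply_false, h₁f, h₁t, hr]
        ring
      · intro x hx
        rw [linearEquiv_mul_apply, linearEquiv_mul_apply,
          moveY_apply_of_ne _ _ _ (by rintro rfl; exact hx rfl),
          moveX_apply_of_ne _ _ _ (by rintro rfl; exact hx rfl), h₁o x hx]
    · -- `(p', q) ↦ (p', q mod p')` with `|q mod p'| < |p'| < |q|`, then induct
      set v₁ := moveX i (-(v (i, false) / v (i, true))) v with hv₁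
      set v₂ := moveY i (-(v (i, true) / (v (i, false) % v (i, true)))) v₁ with hv₂
      have h₂t : v₂ (i, true) = v (i, true) % (v (i, false) % v (i, true)) := by
        rw [hv₂, moveY_apply_true, h₁t, h₁f, Int.emod_def (v (i, true))]; ring
      have hlt : (v₂ (i, true)).natAbs ≤ n := by
        rw [h₂t]
        have h1 := Literature.LinearAlgebra.Matrix.natAbs_emod_lt (v (i, true)) hr
        have h2 := Literature.LinearAlgebra.Matrix.natAbs_emod_lt (v (i, false)) hq
        omega
      obtain ⟨f, hf, hf0, hfo⟩ := ih v₂ hlt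
      refine ⟨f * (moveY i (-(v (i, true) / (v (i, false) % v (i, true)))) *
          moveX i (-(v (i, false) / v (i, true)))),
        G'.mul_mem hf (G'.mul_mem (hY _) (hX _)), ?_, ?_⟩
      · rw [linearEquiv_mul_apply, linearEquiv_mul_apply, ← hv₁, ← hv₂]
        exact hf0
      · intro x hx
        rw [linearEquiv_mul_apply, linearEquiv_mul_apply, ← hv₁, ← hv₂, hfo x hx, hv₂,
          moveY_apply_of_ne _ _ _ (by rintro rfl; exact hx rfl), h₁o x hx]

/-- Euclid on every handle of `s`: all `b`-coordinates on `s` are killed, nothing outside `s`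
is touched. [cite: ZieschangVogtColdewey1980, 3.6.10] -/
theorem exists_mem_forall_apply_true_eq_zero
    (G' : Subgroup ((ι × Bool → ℤ) ≃ₗ[ℤ] (ι × Bool → ℤ))) (s : Finset ι)
    (hX : ∀ i ∈ s, ∀ c, moveX i c ∈ G') (hY : ∀ i ∈ s, ∀ c, moveY i c ∈ G')
    (v : ι × Bool → ℤ) :
    ∃ f ∈ G', (∀ i ∈ s, f v (i, true) = 0) ∧ ∀ x : ι × Bool, x.1 ∉ s → f v x = v x := by
  induction s using Finset.induction_on with
  | empty => exact ⟨1, G'.one_mem, by simp, fun x _ => rfl⟩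
  | insert a s ha ih =>
    obtain ⟨f, hf, hf0, hfo⟩ := ih (fun i hi => hX i (mem_insert_of_mem hi))
      (fun i hi => hY i (mem_insert_of_mem hi))
    obtain ⟨f', hf', hf'0, hf'o⟩ := exists_mem_apply_true_eq_zero G' a
      (hX a (mem_insert_self a s)) (hY a (mem_insert_self a s)) _ (f v) le_rfl
    refine ⟨f' * f, G'.mul_mem hf' hf, ?_, ?_⟩
    · intro i hi
      rw [mem_insert] at hi
      rw [linearEquiv_mul_apply]
      rcases hi with rfl | hi
      · exact hf'0
      · rw [hf'o (i, true) (by rintro rfl; exact ha hi)]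
        exact hf0 i hi
    · intro x hx
      rw [mem_insert, not_or] at hx
      rw [linearEquiv_mul_apply, hf'o x hx.1, hfo x hx.2]

/-- A vector with no `b`-coordinates, no `a`-coordinates on `s` and nothing outside `s`
vanishes. [folklore] -/
theorem eq_zero_of_coords {s : Finset ι} {v : ι × Bool → ℤ} (ha : ∀ i ∈ s, v (i, false) = 0)
    (hb : ∀ i, v (i, true) = 0) (hs : ∀ x : ι × Bool, x.1 ∉ s → v x = 0) : v = 0 := by
  funext ⟨k, b⟩
  cases b
  · by_cases hk : k ∈ s
    · exact ha k hk
    · exact hs (k, false) hk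
  · exact hb k

/-- The rotation `R = X(1) Y(-1) X(1)` of handle `i` (`(p, q) ↦ (q, -p)`) squares to `-1` on the
handle: the sign change of ZVC 3.6.9 (A). [cite: ZieschangVogtColdewey1980, 3.6.9 (A)] -/
theorem rot_sq_apply (i : ι) (v : ι × Bool → ℤ) (x : ι × Bool) :
    (moveX i 1 * moveY i (-1) * moveX i 1 * (moveX i 1 * moveY i (-1) * moveX i 1)) v x =
      if x.1 = i then -v x else v x := by
  obtain ⟨k, b⟩ := x
  by_cases hk : k = i
  · subst hk
    cases b
    · simp only [linearEquiv_mul_apply, moveX_apply_false, moveY_apply_false, moveX_apply_true,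
        moveY_apply_true, if_true]
      ring
    · simp only [linearEquiv_mul_apply, moveX_apply_true, moveY_apply_true, moveX_apply_false,
        moveY_apply_false, if_true]
      ring
  · have h1 : ((k, b) : ι × Bool) ≠ (i, false) := by simp [hk]
    have h2 : ((k, b) : ι × Bool) ≠ (i, true) := by simp [hk]
    simp only [linearEquiv_mul_apply, moveX_apply_of_ne _ _ _ h1, moveY_apply_of_ne _ _ _ h2,
      hk, if_false]

/-- Moving `δ_{aⱼ}` to `δ_{aᵢ}` by two moves of type (C): `Z_{j i}(-1) Z_{i j}(1) δ_{aⱼ} = δ_{aᵢ}`.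
[cite: ZieschangVogtColdewey1980, 3.6.10] -/
theorem moveZ_moveZ_single {i j : ι} (h : i ≠ j) :
    (moveZ j i h.symm (-1) * moveZ i j h 1) (Pi.single (j, false) (1 : ℤ)) =
      Pi.single (i, false) 1 := by
  have hji : ((j, false) : ι × Bool) ≠ (i, false) := by simpa using h.symm
  have hij : ((i, false) : ι × Bool) ≠ (j, false) := by simpa using h
  funext ⟨k, b⟩
  rw [linearEquiv_mul_apply]
  by_cases hk : k = i
  · subst hk
    cases b
    · rw [moveZ_apply_of_ne _ _ _ hij (by simp), moveZ_apply_false]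
      simp [Pi.single_eq_of_ne hij]
    · rw [moveZ_apply_true, moveZ_apply_of_ne _ _ _ (by simp) (by simpa using h)]
      simp
  · by_cases hk' : k = j
    · subst hk'
      cases b
      · rw [moveZ_apply_false, moveZ_apply_of_ne _ _ _ hji (by simp), moveZ_apply_false]
        simp [Pi.single_eq_of_ne hji, Pi.single_eq_of_ne hij]
      · rw [moveZ_apply_of_ne _ _ _ (by simp) (by simpa using hk), moveZ_apply_true]
        simp
    · have h1 : ((k, b) : ι × Bool) ≠ (j, false) := by simp [hk']
      have h2 : ((k, b) : ι × Bool) ≠ (i, true) := by simp [hk]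
      have h3 : ((k, b) : ι × Bool) ≠ (i, false) := by simp [hk]
      have h4 : ((k, b) : ι × Bool) ≠ (j, true) := by simp [hk']
      rw [moveZ_apply_of_ne _ _ _ h1 h2, moveZ_apply_of_ne _ _ _ h3 h4, Pi.single_eq_of_ne h1,
        Pi.single_eq_of_ne h3]

end Euclid

end Literature.Topology.FourManifolds

end
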